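import Literature.NumberTheory.PAdicHodge.UnitRootFramePeriods
import Literature.NumberTheory.PAdicHodge.LegendreOfPeriodHoms
import HarnessLib

/-!
# The `η`-PERIOD HOMOMORPHISM of the unit-root frame: `Pη(a) = ē(a)·f(u)` (Weil coordinate against the formal line × unit-root period)

Topic `Literature/NumberTheory/PAdicHodge`; namespace `Literature.NumberTheory.PAdicHodge`. THEOREMS ONLY (no definition, no named fact, no
instance, no `sorry`). Brick B3a of the ORDINARY (height-one) frame for Kato's explicit reciprocity law (memo
`Summits/BirchSwinnertonDyer/BirchSwinnertonDyer/Cruxes/StarredOptimalManinUnitFiveSeven/Lines/kato-lever-seam-rec-at-cells.md` §17). Data: an elliptic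
curve `W/K₀ ⊆ F`, its Weil tower `e_∞` on `T_pW|_{Γ_F}` (`ℤ_p`-homogeneous, alternating, non-degenerate), a vector `w₀ ∈ T_pW` (the image
`ι(v₀)` of a generator of the rank-one formal Tate module) on which `Γ_F` acts by a character `ρ` (`σw₀ = ρ(σ)•w₀`, `ρ(σ) ≠ 0`), and a unit
`u ∈ A_max` which is a `χρ⁻¹`-period (`ρ(σ)·σu = χ(σ)·u` — `UnitRootFramePeriods.galBmaxPlus_unitRoot_mul`). With
`ē(a) := log_ε e_∞(a, w₀) ∈ ℤ_p` (`epsLineEquiv`) and `f = bmaxPlusToBdR`: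

★★ `exists_etaPeriodHom_unitRoot` — **there is an additive `Pη : T_pW → B_dR⁺(F)` with `Pη(a) = ι(ē a)·f(u)`** which is `ℤ_p`-LINEAR
(`e_∞(c•a, w₀) = e_∞(a,w₀)^c`), `Γ_F`-EQUIVARIANT (`e_∞(σa, σw₀) = σ e_∞(a, w₀)`, `σw₀ = ρ(σ)w₀`, `log_ε(σζ) = χ(σ)log_ε ζ`, and the period
property of `u`), NOT `Fil¹`-valued (`ē ≢ 0` by non-degeneracy + alternation, `θ(f u) ≠ 0`), and **vanishes on the formal line `ℤ_p·w₀`**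
(alternation) — the hypotheses `hPηZ`, `hPη`, `hnot` of the socket `TatePairingPointOfKTwoBasis` and the reason `b_η = 0` integrates `Pη ∘ κ` for a
FORMAL Kummer cocycle. Infrastructure only: BSD / K★ (`stmt-BirchSwinnertonDyer-22226`) are NOT proved by any of this.

## References
* K. Kato, LNM 1553 (1993), Ch. II §1.4 (1.4.2), Thm. 1.4.1, Lemma 1.4.3. [Kato1993LNM1553]
* J. Tate, *p-divisible groups* (1967), §4 (the connected–étale sequence and the Weil pairing: `T_pÊ` is isotropic). [Tate1967]
* J.-M. Fontaine, Astérisque 223 (1994), Exp. II §1.5.4–1.5.5. [FontaineAsterisque223III]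
-/

noncomputable section

open Field Function ValuativeRel WittVector

namespace Literature.NumberTheory.PAdicHodge

open Literature.NumberTheory.GaloisRepresentations
open Literature.NumberTheory.GaloisRepresentations.IsNonarchimedeanLocalField
open Literature.NumberTheory.GaloisCohomology
open Literature.NumberTheory.EllipticCurves
open _root_.WeierstrassCurve GaloisContinuity

variable {F : Type} [Field F] [ValuativeRel F] [TopologicalSpace F] [IsNonarchimedeanLocalField F] [CharZero F]
  {p : ℕ} [Fact p.Prime] [Fact (¬ IsUnit (p : integerC F))] [IsAdicComplete (Ideal.span {(p : integerC F)}) (integerC F)]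
  {K₀ : Type} [Field K₀] [CharZero K₀] (W : WeierstrassCurve K₀) [Algebra K₀ F] [W.IsElliptic]
  (e : (k : ℕ) → geomTorsion W ((p ^ k : ℕ) : ℤ) → geomTorsion W ((p ^ k : ℕ) : ℤ) → AlgebraicClosure K₀)
  (hμ : ∀ k S T, e k S T ^ (p ^ k) = 1) (hadd₁ : ∀ k S₁ S₂ T, e k (S₁ + S₂) T = e k S₁ T * e k S₂ T)
  (hadd₂ : ∀ k S T₁ T₂, e k S (T₁ + T₂) = e k S T₁ * e k S T₂)
  (hgal : ∀ k (σ : absoluteGaloisGroup K₀) (S T : geomTorsion W ((p ^ k : ℕ) : ℤ)), σ • e k S T = e k (σ • S) (σ • T))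
  (hcompat : ∀ k (S T : geomTorsion W ((p ^ (k + 1) : ℕ) : ℤ)),
    e k (torsionMulHom W (p ^ (k + 1)) (p ^ k) p (pow_succ p k).symm S)
      (torsionMulHom W (p ^ (k + 1)) (p ^ k) p (pow_succ p k).symm T) = e (k + 1) S T ^ p)

omit [Fact (¬ IsUnit (p : integerC F))] [IsAdicComplete (Ideal.span {(p : integerC F)}) (integerC F)] in
/-- `log_ε (ζ^c) = log_ε ζ · c`. [cite: Kato1993LNM1553, Ch. II 1.4.2] -/
theorem epsLineEquiv_symm_twistHom (ζ : (muPadicSystem F p).limit) (c : ℤ_[p]) :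
    (epsLineEquiv F p).symm (twistHom F p ζ c) = (epsLineEquiv F p).symm ζ * c := by
  obtain ⟨b, rfl⟩ := (epsLineEquiv F p).surjective ζ
  rw [show twistHom F p (epsLineEquiv F p b) c = epsLineEquiv F p (b * c) by
      rw [epsLineEquiv_apply, epsLineEquiv_apply, twistHom_twistHom],
    AddEquiv.symm_apply_apply, AddEquiv.symm_apply_apply]

omit [CharZero K₀] [W.IsElliptic] in
include hgal in
set_option maxHeartbeats 1600000 in
/-- ★★ **The `η`-period homomorphism of the unit-root frame.** With `ē(a) = log_ε e_∞(a, w₀)` (`σw₀ = ρ(σ)•w₀`, `ρ(σ) ≠ 0`) and a unit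
`u ∈ A_max` with `ρ(σ)·σu = χ(σ)·u`: there is an additive `Pη : T_pW → B_dR⁺(F)`, **`Pη(a) = ι(ē a)·f(u)`**, which is `ℤ_p`-linear,
`Γ_F`-equivariant, takes a value outside `Fil¹`, and VANISHES on `ℤ_p·w₀`. [cite: Kato1993LNM1553, Ch. II §1.4] [cite: Tate1967, §4]
[cite: FontaineAsterisque223III, Exp. II §1.5.5] -/
theorem exists_etaPeriodHom_unitRoot (hF : Function.Surjective (fontaineTheta (integerC F) p))
    (heL : ∀ (c : ℤ_[p]) (S U : W.tateModule p), (weilContPairingPadic W F p e hμ hadd₁ hadd₂ hgal hcompat).toLin (c • S) U =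
      twistHom F p ((weilContPairingPadic W F p e hμ hadd₁ hadd₂ hgal hcompat).toLin S U) c)
    (healt : ∀ S : W.tateModule p, (weilContPairingPadic W F p e hμ hadd₁ hadd₂ hgal hcompat).toLin S S = 0)
    (henondeg : ∀ S : W.tateModule p, (∀ U, (weilContPairingPadic W F p e hμ hadd₁ hadd₂ hgal hcompat).toLin S U = 0) → S = 0)
    {w₀ : W.tateModule p} (hw₀ : w₀ ≠ 0) (ρ : absoluteGaloisGroup F → ℤ_[p]) (hρ0 : ∀ σ, ρ σ ≠ 0)
    (hρw : ∀ σ, restrictedTateRep W F p σ w₀ = ρ σ • w₀)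
    {u : BmaxPlus F p} (hu : IsUnit u)
    (hper : ∀ σ, ainfToBmaxPlus F p (zpToAinf (ρ σ)) * galBmaxPlus σ u =
      ainfToBmaxPlus F p (zpToAinf ((GaloisRep.cyclotomicCharacter F p σ : ℤ_[p]ˣ) : ℤ_[p])) * u) :
    ∃ Pη : W.tateModule p →+ BdRPlusTop F p,
      (∀ a, Pη a = BdRPlusTop.of F p (qpToBdR ((((epsLineEquiv F p).symm
        ((weilContPairingPadic W F p e hμ hadd₁ hadd₂ hgal hcompat).toLin a w₀) : ℤ_[p]) : ℚ_[p])) * bmaxPlusToBdR F p u)) ∧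
      (∀ (c : ℤ_[p]) (a : W.tateModule p), Pη (c • a) = BdRPlusTop.of F p (qpToBdR (c : ℚ_[p])) * Pη a) ∧
      (∀ (σ : absoluteGaloisGroup F) (a : W.tateModule p), BdRPlusTop.gal F p σ (Pη a) = Pη (restrictedTateRep W F p σ a)) ∧
      (∃ a, Pη a ∉ (BdRPlusTop.filOne F p).toIdeal) ∧
      (∀ c : ℤ_[p], Pη (c • w₀) = 0) := by
  set E := weilContPairingPadic W F p e hμ hadd₁ hadd₂ hgal hcompat with hE
  -- the Weil coordinate `ē`
  set eb : W.tateModule p →+ ℤ_[p] := (epsLineEquiv F p).symm.toAddMonoidHom.comp (E.toLin.flip w₀).toAddMonoidHom with heb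
  have heb_apply : ∀ a, eb a = (epsLineEquiv F p).symm (E.toLin a w₀) := fun a => rfl
  have heR : ∀ (c : ℤ_[p]) (S U : W.tateModule p), E.toLin S (c • U) = twistHom F p (E.toLin S U) c := fun c S U => by
    rw [hE, weilContPairingPadic_toLin_apply, weilContPairingPadic_toLin_apply]
    exact weilPairingPadicHom_smul_right W e hμ hadd₁ hadd₂ hcompat S U c
  have heb_smul : ∀ (c : ℤ_[p]) a, eb (c • a) = c * eb a := fun c a => by
    rw [heb_apply, heb_apply, heL, epsLineEquiv_symm_twistHom, mul_comm]
  -- `ρ(σ)·ē(σa) = χ(σ)·ē(a)`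
  have heb_gal : ∀ σ a, ρ σ * eb (restrictedTateRep W F p σ a) = ((GaloisRep.cyclotomicCharacter F p σ : ℤ_[p]ˣ) : ℤ_[p]) * eb a := by
    intro σ a
    have h1 : E.toLin (restrictedTateRep W F p σ a) (restrictedTateRep W F p σ w₀) = tateModuleMuPadic F p σ (E.toLin a w₀) :=
      E.toLin_smul σ a w₀
    rw [hρw, heR] at h1
    have h2 := congrArg (epsLineEquiv F p).symm h1
    rw [epsLineEquiv_symm_twistHom, epsLineEquiv_symm_tateModuleMuPadic] at h2
    rw [heb_apply, heb_apply, mul_comm]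
    exact h2
  set U : BdRPlusTop F p := BdRPlusTop.of F p (bmaxPlusToBdR F p u) with hUdef
  refine ⟨AddMonoidHom.mk' (fun a => BdRPlusTop.of F p (qpToBdR ((eb a : ℤ_[p]) : ℚ_[p])) * U) (fun a a' => by
      rw [map_add, PadicInt.coe_add, map_add, map_add, add_mul]), fun a => rfl, ?_, ?_, ?_, ?_⟩
  · -- `ℤ_p`-linearity
    intro c a
    change BdRPlusTop.of F p (qpToBdR ((eb (c • a) : ℤ_[p]) : ℚ_[p])) * U =
      BdRPlusTop.of F p (qpToBdR (c : ℚ_[p])) * (BdRPlusTop.of F p (qpToBdR ((eb a : ℤ_[p]) : ℚ_[p])) * U)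
    rw [heb_smul, PadicInt.coe_mul, map_mul, map_mul, mul_assoc]
  · -- equivariance
    intro σ a
    change BdRPlusTop.gal F p σ (BdRPlusTop.of F p (qpToBdR ((eb a : ℤ_[p]) : ℚ_[p])) * U) =
      BdRPlusTop.of F p (qpToBdR ((eb (restrictedTateRep W F p σ a) : ℤ_[p]) : ℚ_[p])) * U
    have hρunit : IsUnit (BdRPlusTop.of F p (qpToBdR ((ρ σ : ℤ_[p]) : ℚ_[p]))) :=
      ((IsUnit.mk0 _ (PadicInt.coe_ne_zero.2 (hρ0 σ))).map qpToBdR).map _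
    refine hρunit.mul_left_cancel ?_
    have hperf : qpToBdR ((ρ σ : ℤ_[p]) : ℚ_[p]) * galBdRPlus σ (bmaxPlusToBdR F p u) =
        qpToBdR ((((GaloisRep.cyclotomicCharacter F p σ : ℤ_[p]ˣ) : ℤ_[p]) : ℤ_[p]) : ℚ_[p]) * bmaxPlusToBdR F p u := by
      have h := congrArg (bmaxPlusToBdR F p) (hper σ)
      rwa [map_mul, map_mul, bmaxPlusToBdR_ainfToBmaxPlus_zpToAinf, bmaxPlusToBdR_ainfToBmaxPlus_zpToAinf, ← galBdRPlus_bmaxPlusToBdR] at h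
    have hL : BdRPlusTop.gal F p σ (BdRPlusTop.of F p (qpToBdR ((eb a : ℤ_[p]) : ℚ_[p])) * U) =
        BdRPlusTop.of F p (qpToBdR ((eb a : ℤ_[p]) : ℚ_[p]) * galBdRPlus σ (bmaxPlusToBdR F p u)) := by
      rw [hUdef, ← map_mul, BdRPlusTop.gal_of, map_mul, galBdRPlus_qpToBdR]
    have h2 : qpToBdR ((ρ σ : ℤ_[p]) : ℚ_[p]) * qpToBdR ((eb (restrictedTateRep W F p σ a) : ℤ_[p]) : ℚ_[p]) =
        qpToBdR ((((GaloisRep.cyclotomicCharacter F p σ : ℤ_[p]ˣ) : ℤ_[p]) : ℤ_[p]) : ℚ_[p]) *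
          (qpToBdR ((eb a : ℤ_[p]) : ℚ_[p]) : BDeRhamPlus (integerC F) p) := by
      rw [← map_mul, ← map_mul, ← PadicInt.coe_mul, ← PadicInt.coe_mul, heb_gal]
    rw [hL, hUdef, ← map_mul, ← map_mul, ← map_mul]
    congr 1
    linear_combination (qpToBdR ((eb a : ℤ_[p]) : ℚ_[p]) : BDeRhamPlus (integerC F) p) * hperf - bmaxPlusToBdR F p u * h2
  · -- a value outside `Fil¹`
    haveI : IsDomain (BDeRhamPlus (integerC F) p) := isDomain_bDeRhamPlus hF
    have hex : ∃ a, E.toLin a w₀ ≠ 0 := by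
      by_contra hall
      refine hw₀ (henondeg w₀ fun T => ?_)
      have h0 : E.toLin T w₀ = 0 := not_ne_iff.1 (not_exists.1 hall T)
      have halt' : E.toLin (w₀ + T) (w₀ + T) = 0 := healt _
      rw [E.toLin.map_add, LinearMap.add_apply, (E.toLin w₀).map_add, (E.toLin T).map_add, healt, healt, h0] at halt'
      simpa using halt'
    obtain ⟨a, ha⟩ := hex
    refine ⟨a, fun hmem => ?_⟩
    have hθ := thetaBdR_eq_zero_of_mem_span_xiBdR_pow (F := F) (p := p) le_rfl
      (by rw [pow_one]; exact BdRPlusTop.mem_filOne_iff.1 hmem)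
    change thetaBdR ((BdRPlusTop.of F p).symm (BdRPlusTop.of F p (qpToBdR ((eb a : ℤ_[p]) : ℚ_[p])) * U)) = 0 at hθ
    rw [hUdef, ← map_mul, RingEquiv.symm_apply_apply, map_mul, thetaBdR_bmaxPlusToBdR, mul_eq_zero] at hθ
    rcases hθ with h1 | h2
    · have hne : eb a ≠ 0 := fun h0 => ha ((epsLineEquiv F p).symm.injective (by rw [← heb_apply, h0, map_zero]))
      have hq : IsUnit (qpToBdR ((eb a : ℤ_[p]) : ℚ_[p]) : BDeRhamPlus (integerC F) p) :=
        (IsUnit.mk0 _ (PadicInt.coe_ne_zero.2 hne)).map qpToBdR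
      exact ((isUnit_iff_thetaBdR_ne_zero hF _).1 hq) h1
    · have hθu : IsUnit (thetaBmaxPlus F p u) := hu.map _
      exact hθu.ne_zero (by exact_mod_cast h2)
  · -- vanishing on the formal line
    intro c
    change BdRPlusTop.of F p (qpToBdR ((eb (c • w₀) : ℤ_[p]) : ℚ_[p])) * U = 0
    rw [heb_smul, heb_apply, healt, map_zero, mul_zero, PadicInt.coe_zero, map_zero, map_zero, zero_mul]

end Literature.NumberTheory.PAdicHodge

end
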